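import Summits.QuantumFields.YangMills.Theorems.UnitScaleGibbsLinProxySU2Letters
import Summits.QuantumFields.YangMills.Theorems.UnitScaleGibbsActionDerivativeSlotCalculus
import HarnessLib

/-!
# The `SU(2)` identification of the scalar-weight linear proxy with the three flux pairings
# — a deterministic letter of LINE 28's `stub_linTest` (crux `HistoryTailL`, stmt-QuantumFields-19936; construction C3 «tree-gauge dressing»)

Cell `ym3-torus` (YM ladder rung R3 = continuum SU(2) Yang–Mills on T³ — a RUNG, NOT the Clay problem: not d = 4, not infinite volume, not a
mass gap); width seat `ym3-torus-px5` g10.  Helper `--supports stmt-QuantumFields-23083` (LINE 28's registered item; crux of record 19936);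
THEOREMS ONLY (0 `def`, 0 `sorry`, default heartbeats); one configuration, no measure, no averaging.  FILE 2 of 2 — the `SU(2)` letters (§1) are ✓`UnitScaleGibbsLinProxySU2Letters`, used BY NAME.

WHY (ideator ym-r3-idea-2 g16, LINE 28 skeleton v1 `line-gross_transfer.v1.lean` c904a77a, `stub_linTest`; ★w2-19936 g14 18:00:56Z «STILL OPEN
for stub_lin: … the `dist₁ ↔ ⟨du⁰, F(V)⟩` identification with `stub_test`'s least-squares `u⁰`»).  On the small-field event the block plaquette
deviation is, by ✓`UnitScaleGibbsBlockPlaquetteTransportFreeLinearisation.norm_iter_plaqHol_sub_one_sub_linProxy_le` (w2, (M3♭)), the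
SCALAR-WEIGHT LINEAR PROXY `M := Σ_p w_p·(↑V(∂p) − 1)` (`w = linWeight j a`, operator norm) up to a second-order budget; the Schwinger–Dyson
side (`stub_condSD`, ✓`UnitScaleGibbsFirstVariationFluxPairing` px10) controls the FLAT FLUX PAIRINGS `Σ_p Re Tr((du_α)_p·(↑V(∂p) − 1))` of
`𝔰𝔲(2)`-valued test fields.  This file is the seam between the two: with `u_α := u⁰ ⊗ τ_α` (`τ_α = iσ_α`, ✓`B10Eq18SigmaSU2.pauli`) and `u⁰`
ANY real bond function `u` (e.g. a least-squares potential of `w`, ✓`UnitScaleGibbsBoxLeastSquaresPotential`, w5),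
  `‖M‖ ≤ Σ_α |Σ_p (du)_p·Re Tr(τ_α(↑V(∂p) − 1))| + Σ_α |⟨w − du, dg_α⟩| + 132η²·Σ_p|w_p − (du)_p| + 8η²·Σ_p|w_p|`
whenever the slots of the plaquettes in `supp w ∪ supp du` are within `η ≤ 1` of `1` (the axial-gauge box, ✓`T4AxialGaugeSmallField`);
`g_α b := Re Tr(τ_α(↑V_b − 1))` is the real 1-form whose lattice curl the Pauli trace of a plaquette is, to second order.  The DEFECT
`D_α := ⟨w − du, dg_α⟩` is displayed, NOT assumed away: for weights with non-zero orientation sums (`Σ_p linWeight j a p = (L²)^j`) no `u` with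
box-supported curl kills it (w5-19936 g16's (NET-FLUX) double-counting theorem; this seat's kit j334943∕j334956: the margin-1 least-squares
system misses the wall normal equations, the full-box one puts `Σ_wall|u| ≈ 1.5·(L²)^j` on the wall) — it is the seam the line must still
control.

* §1 = FILE 1 ✓`UnitScaleGibbsLinProxySU2Letters` (`SU(2)` algebra: ★★★`norm_sum_smul_sub_one_le`, the Pauli letters).
* §2 LINEARISATION: ★`norm_fourProd_sub_one_sub_lin_le` (`‖V₀V₁W₂W₃ − 1 − Σ(·−1)‖ ≤ 11η²`, any `N`), ★`re_trace_mul_conjTranspose_of_skew`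
  (`Re Tr(τAᴴ) = −Re Tr(τA)`), `coe_plaqHol_eq` (the plaquette word over ✓`slotBond`), ★★`abs_re_trace_plaq_sub_curl_le`: the Pauli trace of
  `↑V(∂p) − 1` is the LATTICE CURL of the real 1-form `g_α b := Re Tr(τ_α(↑V_b − 1))` up to `44η²`.
* §3 DEFECT IDENTITY (pure finite sums): ★`sum_mul_eq_sum_mul_add_defect`, `abs_sum_mul_le_add_defect` — replacing `w` by `du` in a pairing
  with `f = dg + e` costs the NORMAL-EQUATION DEFECT `Σ (w − du)·dg` plus the non-exact part `Σ (w − du)·e`.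
* §4 ★★★`norm_linProxy_le_fluxPairing_add_defect` (THE IDENTIFICATION WITH ITS DEFECT, above; NO normal-equation hypothesis — the defect
  `D_α = ⟨w − du, dg_α⟩` is DISPLAYED) + `sum_mul_re_trace_eq_re_trace_sum` (the first term IS `Re Tr Σ_p((du)_p•τ_α)(↑V(∂p) − 1)`, the
  pairing of the `𝔰𝔲(2)`-valued curl `d(u ⊗ τ_α)`) + `norm_coe_plaqHol_sub_one_le` (`dist₁(V(∂p)) ≤ 4η`).

HONEST SCOPE.  Deterministic matrix∕lattice algebra about ONE configuration; NO normal equations are assumed (the defect term carries them);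
nothing of
`stub_linTest`, `stub_condSD`, `stub_hessOnEvent`, `stub_peierls0`, «ShallowFluxSecondMomentL», (Q), 23083∕23133∕23134, K1, `MeanDeviationL`,
`HistoryTailL`, the rung R3, d = 4, a continuum limit or a mass gap is proved here; the Yang–Mills mass gap is NOT proved.

References: L. Gross, CMP 92 (1983) 137–162, Thm 2.2 (the flux pairing `⟨du, F⟩` as the Schwinger–Dyson observable) [GrossCMP1983];
T. Bałaban, CMP 109 (1987) 249–301, (0.14) p.254 (`|U − 1|² = 2[1 − Re tr U]` on `SU(2)`) [Balaban1987RG1]; CMP 98 (1985) 17–51, (19) p.21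
[Balaban1985Averaging]; M. Creutz, Quarks, Gluons and Lattices, Ch. 11 [Creutz2022].
-/

set_option autoImplicit false

noncomputable section

open scoped BigOperators Matrix Matrix.Norms.L2Operator ComplexConjugate
open Complex Finset
open Literature.MathematicalPhysics.QuantumFieldTheory.Balaban1983to89
open Literature.MathematicalPhysics.QuantumFieldTheory.Balaban1983to89.MatrixNorms (norm_ntr_le_opNorm ntr)
open Literature.MathematicalPhysics.QuantumFieldTheory.Balaban1983to89.B10Eq18SigmaSU2 (pauli)
open Summit.QuantumFields.YangMills.Theorems.UnitScaleGibbsLinProxySU2Letters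

namespace Summit.QuantumFields.YangMills.Theorems.UnitScaleGibbsLinProxyFluxIdentification

/-! ## §2  Second-order linearisation of a plaquette word (any `N`), and the Pauli trace of a plaquette is a lattice curl to second order -/

section Linearisation

variable {N : ℕ}

/-- `XY − 1 − ((X − 1) + (Y − 1)) = (X − 1)(Y − 1)`. [folklore] -/
theorem mul_sub_one_sub_eq (X Y : Matrix (Fin N) (Fin N) ℂ) :
    X * Y - 1 - ((X - 1) + (Y - 1)) = (X - 1) * (Y - 1) := by noncomm_ring

/-- `‖XY − 1 − ((X − 1) + (Y − 1))‖ ≤ ‖X − 1‖·‖Y − 1‖` (operator norm). [folklore] -/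
theorem norm_mul_sub_one_sub_le (X Y : Matrix (Fin N) (Fin N) ℂ) :
    ‖X * Y - 1 - ((X - 1) + (Y - 1))‖ ≤ ‖X - 1‖ * ‖Y - 1‖ := by
  rw [mul_sub_one_sub_eq]; exact Matrix.l2_opNorm_mul _ _

/-- `‖XY − 1‖ ≤ ‖X − 1‖ + ‖Y − 1‖ + ‖X − 1‖·‖Y − 1‖`. [folklore] -/
theorem norm_mul_sub_one_le (X Y : Matrix (Fin N) (Fin N) ℂ) :
    ‖X * Y - 1‖ ≤ ‖X - 1‖ + ‖Y - 1‖ + ‖X - 1‖ * ‖Y - 1‖ := by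
  have h := norm_mul_sub_one_sub_le X Y
  have h2 : X * Y - 1 = (X * Y - 1 - ((X - 1) + (Y - 1))) + ((X - 1) + (Y - 1)) := by abel
  calc ‖X * Y - 1‖ = ‖(X * Y - 1 - ((X - 1) + (Y - 1))) + ((X - 1) + (Y - 1))‖ := by rw [← h2]
    _ ≤ ‖X * Y - 1 - ((X - 1) + (Y - 1))‖ + ‖(X - 1) + (Y - 1)‖ := norm_add_le _ _
    _ ≤ ‖X - 1‖ * ‖Y - 1‖ + (‖X - 1‖ + ‖Y - 1‖) := add_le_add h (norm_add_le _ _)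
    _ = _ := by ring

/-- ★ **FOUR-FACTOR LINEARISATION**: `‖V₀V₁W₂W₃ − 1 − ((V₀−1)+(V₁−1)+(W₂−1)+(W₃−1))‖ ≤ 11η²` when all four
factors are within `η ≤ 1` of `1` (telescoping `XY − 1 − (X−1) − (Y−1) = (X−1)(Y−1)` three times). [folklore] -/
theorem norm_fourProd_sub_one_sub_lin_le (V₀ V₁ W₂ W₃ : Matrix (Fin N) (Fin N) ℂ) {η : ℝ} (hη0 : 0 ≤ η) (hη1 : η ≤ 1)
    (h0 : ‖V₀ - 1‖ ≤ η) (h1 : ‖V₁ - 1‖ ≤ η) (h2 : ‖W₂ - 1‖ ≤ η) (h3 : ‖W₃ - 1‖ ≤ η) :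
    ‖V₀ * V₁ * W₂ * W₃ - 1 - ((V₀ - 1) + (V₁ - 1) + (W₂ - 1) + (W₃ - 1))‖ ≤ 11 * η ^ 2 := by
  -- the partial products
  have hP1 : ‖V₀ * V₁ - 1‖ ≤ 3 * η := by
    calc ‖V₀ * V₁ - 1‖ ≤ ‖V₀ - 1‖ + ‖V₁ - 1‖ + ‖V₀ - 1‖ * ‖V₁ - 1‖ := norm_mul_sub_one_le _ _
      _ ≤ η + η + η * η := by gcongr
      _ ≤ 3 * η := by nlinarith
  have hP2 : ‖V₀ * V₁ * W₂ - 1‖ ≤ 7 * η := by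
    calc ‖V₀ * V₁ * W₂ - 1‖ ≤ ‖V₀ * V₁ - 1‖ + ‖W₂ - 1‖ + ‖V₀ * V₁ - 1‖ * ‖W₂ - 1‖ := norm_mul_sub_one_le _ _
      _ ≤ 3 * η + η + (3 * η) * η := by gcongr
      _ ≤ 7 * η := by nlinarith
  -- the three telescoping remainders
  have hR1 := norm_mul_sub_one_sub_le V₀ V₁
  have hR2 := norm_mul_sub_one_sub_le (V₀ * V₁) W₂
  have hR3 := norm_mul_sub_one_sub_le (V₀ * V₁ * W₂) W₃
  have hdec : V₀ * V₁ * W₂ * W₃ - 1 - ((V₀ - 1) + (V₁ - 1) + (W₂ - 1) + (W₃ - 1)) =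
      (V₀ * V₁ - 1 - ((V₀ - 1) + (V₁ - 1))) + (V₀ * V₁ * W₂ - 1 - ((V₀ * V₁ - 1) + (W₂ - 1))) +
        (V₀ * V₁ * W₂ * W₃ - 1 - ((V₀ * V₁ * W₂ - 1) + (W₃ - 1))) := by abel
  rw [hdec]
  calc _ ≤ ‖V₀ * V₁ - 1 - ((V₀ - 1) + (V₁ - 1))‖ + ‖V₀ * V₁ * W₂ - 1 - ((V₀ * V₁ - 1) + (W₂ - 1))‖ +
        ‖V₀ * V₁ * W₂ * W₃ - 1 - ((V₀ * V₁ * W₂ - 1) + (W₃ - 1))‖ := norm_add₃_le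
    _ ≤ ‖V₀ - 1‖ * ‖V₁ - 1‖ + ‖V₀ * V₁ - 1‖ * ‖W₂ - 1‖ + ‖V₀ * V₁ * W₂ - 1‖ * ‖W₃ - 1‖ :=
        add_le_add (add_le_add hR1 hR2) hR3
    _ ≤ η * η + (3 * η) * η + (7 * η) * η := by gcongr
    _ = 11 * η ^ 2 := by ring

/-- ★ For a skew-Hermitian `τ`: `Re Tr(τ Aᴴ) = −Re Tr(τ A)` — the inverse slots of a plaquette enter the Pauli traces with a sign.
[folklore] -/
theorem re_trace_mul_conjTranspose_of_skew (τ A : Matrix (Fin N) (Fin N) ℂ) (hτ : τᴴ = -τ) :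
    (τ * Aᴴ).trace.re = -(τ * A).trace.re := by
  have h : τ * Aᴴ = -(A * τ)ᴴ := by
    rw [Matrix.conjTranspose_mul, hτ]; noncomm_ring
  rw [h, Matrix.trace_neg, Matrix.trace_conjTranspose, Matrix.trace_mul_comm A τ]
  simp

/-- The coercion of a plaquette variable of an `SU(2)`-valued field to matrices: `↑V₀ · ↑V₁ · (↑V₂)ᴴ · (↑V₃)ᴴ` over the four
slots of ✓`UnitScaleGibbsActionDerivativeSlotCalculus.slotBond`. [cite: Creutz2022, Ch. 11] -/
theorem coe_plaqHol_eq {P : Params} {j : ℕ} (V : GaugeField P j (Matrix.specialUnitaryGroup (Fin 2) ℂ)) (p : Plaq P j) :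
    ((GaugeField.plaqHol V p : Matrix.specialUnitaryGroup (Fin 2) ℂ) : Matrix (Fin 2) (Fin 2) ℂ) =
      (V (UnitScaleGibbsActionDerivativeSlotCalculus.slotBond p 0) : Matrix (Fin 2) (Fin 2) ℂ) *
        (V (UnitScaleGibbsActionDerivativeSlotCalculus.slotBond p 1) : Matrix (Fin 2) (Fin 2) ℂ) *
        ((V (UnitScaleGibbsActionDerivativeSlotCalculus.slotBond p 2) : Matrix (Fin 2) (Fin 2) ℂ))ᴴ *
        ((V (UnitScaleGibbsActionDerivativeSlotCalculus.slotBond p 3) : Matrix (Fin 2) (Fin 2) ℂ))ᴴ := by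
  simp only [GaugeField.plaqHol, UnitScaleGibbsActionDerivativeSlotCalculus.slotBond, Matrix.cons_val_zero,
    Matrix.cons_val_one, Matrix.head_cons, Matrix.cons_val_two, Matrix.tail_cons, Matrix.cons_val_three]
  rfl

/-- ★★ **THE PAULI∕SKEW TRACE OF A PLAQUETTE IS A LATTICE CURL TO SECOND ORDER**: for a skew-Hermitian `2 × 2` `τ` with `‖τ‖ ≤ 2`
and an `SU(2)` field whose four slot variables of `p` are within `η ≤ 1` of `1`, the real 1-form `g b := Re Tr(τ(↑V_b − 1))` satisfies
`|Re Tr(τ(↑V(∂p) − 1)) − (g(b₀) + g(b₁) − g(b₂) − g(b₃))| ≤ 44η²`. [cite: GrossCMP1983, proof of Thm 2.2] -/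
theorem abs_re_trace_plaq_sub_curl_le {P : Params} {j : ℕ} (V : GaugeField P j (Matrix.specialUnitaryGroup (Fin 2) ℂ))
    (p : Plaq P j) (τ : Matrix (Fin 2) (Fin 2) ℂ) (hτ : τᴴ = -τ) (hτ2 : ‖τ‖ ≤ 2) {η : ℝ} (hη0 : 0 ≤ η) (hη1 : η ≤ 1)
    (hV : ∀ i : Fin 4, ‖(V (UnitScaleGibbsActionDerivativeSlotCalculus.slotBond p i) : Matrix (Fin 2) (Fin 2) ℂ) - 1‖ ≤ η) :
    |(τ * (((GaugeField.plaqHol V p : Matrix.specialUnitaryGroup (Fin 2) ℂ) : Matrix (Fin 2) (Fin 2) ℂ) - 1)).trace.re -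
        ((τ * ((V (UnitScaleGibbsActionDerivativeSlotCalculus.slotBond p 0) : Matrix (Fin 2) (Fin 2) ℂ) - 1)).trace.re +
          (τ * ((V (UnitScaleGibbsActionDerivativeSlotCalculus.slotBond p 1) : Matrix (Fin 2) (Fin 2) ℂ) - 1)).trace.re -
          (τ * ((V (UnitScaleGibbsActionDerivativeSlotCalculus.slotBond p 2) : Matrix (Fin 2) (Fin 2) ℂ) - 1)).trace.re -
          (τ * ((V (UnitScaleGibbsActionDerivativeSlotCalculus.slotBond p 3) : Matrix (Fin 2) (Fin 2) ℂ) - 1)).trace.re)| ≤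
      44 * η ^ 2 := by
  set V₀ : Matrix (Fin 2) (Fin 2) ℂ := (V (UnitScaleGibbsActionDerivativeSlotCalculus.slotBond p 0) : Matrix (Fin 2) (Fin 2) ℂ)
  set V₁ : Matrix (Fin 2) (Fin 2) ℂ := (V (UnitScaleGibbsActionDerivativeSlotCalculus.slotBond p 1) : Matrix (Fin 2) (Fin 2) ℂ)
  set V₂ : Matrix (Fin 2) (Fin 2) ℂ := (V (UnitScaleGibbsActionDerivativeSlotCalculus.slotBond p 2) : Matrix (Fin 2) (Fin 2) ℂ)
  set V₃ : Matrix (Fin 2) (Fin 2) ℂ := (V (UnitScaleGibbsActionDerivativeSlotCalculus.slotBond p 3) : Matrix (Fin 2) (Fin 2) ℂ)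
  have hcoe : ((GaugeField.plaqHol V p : Matrix.specialUnitaryGroup (Fin 2) ℂ) : Matrix (Fin 2) (Fin 2) ℂ) = V₀ * V₁ * V₂ᴴ * V₃ᴴ :=
    coe_plaqHol_eq V p
  -- the linearisation remainder `Q`
  set Q : Matrix (Fin 2) (Fin 2) ℂ := V₀ * V₁ * V₂ᴴ * V₃ᴴ - 1 - ((V₀ - 1) + (V₁ - 1) + (V₂ᴴ - 1) + (V₃ᴴ - 1)) with hQ
  have h2' : ‖V₂ᴴ - 1‖ ≤ η := by
    rw [← Matrix.conjTranspose_one, ← Matrix.conjTranspose_sub, Matrix.l2_opNorm_conjTranspose]; exact hV 2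
  have h3' : ‖V₃ᴴ - 1‖ ≤ η := by
    rw [← Matrix.conjTranspose_one, ← Matrix.conjTranspose_sub, Matrix.l2_opNorm_conjTranspose]; exact hV 3
  have hQle : ‖Q‖ ≤ 11 * η ^ 2 := norm_fourProd_sub_one_sub_lin_le V₀ V₁ V₂ᴴ V₃ᴴ hη0 hη1 (hV 0) (hV 1) h2' h3'
  -- decompose the plaquette trace
  have hsplit : τ * (V₀ * V₁ * V₂ᴴ * V₃ᴴ - 1) =
      τ * (V₀ - 1) + τ * (V₁ - 1) + τ * (V₂ - 1)ᴴ + τ * (V₃ - 1)ᴴ + τ * Q := by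
    rw [hQ, Matrix.conjTranspose_sub, Matrix.conjTranspose_sub, Matrix.conjTranspose_one]; noncomm_ring
  rw [hcoe, hsplit]
  simp only [Matrix.trace_add, Complex.add_re, re_trace_mul_conjTranspose_of_skew τ _ hτ]
  have hτQ : |(τ * Q).trace.re| ≤ 44 * η ^ 2 := by
    calc |(τ * Q).trace.re| ≤ 2 * ‖τ * Q‖ := abs_re_trace_le_two_mul_norm _
      _ ≤ 2 * (‖τ‖ * ‖Q‖) := by gcongr; exact Matrix.l2_opNorm_mul _ _
      _ ≤ 2 * (2 * (11 * η ^ 2)) := by gcongr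
      _ = 44 * η ^ 2 := by ring
  have : (τ * (V₀ - 1)).trace.re + (τ * (V₁ - 1)).trace.re + -(τ * (V₂ - 1)).trace.re + -(τ * (V₃ - 1)).trace.re +
        (τ * Q).trace.re -
      ((τ * (V₀ - 1)).trace.re + (τ * (V₁ - 1)).trace.re - (τ * (V₂ - 1)).trace.re - (τ * (V₃ - 1)).trace.re) =
      (τ * Q).trace.re := by ring
  rw [this]
  exact hτQ

end Linearisation

/-! ## §3  The defect identity (pure finite sums): replacing the weight `w` by a curl `du` in a pairing -/

section Defect

variable {ι : Type*} [Fintype ι]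

/-- ★ **DEFECT IDENTITY**: if `f = dg + e` pointwise then `Σ_p w_p f_p = Σ_p du_p f_p + Σ_p (w_p − du_p)·dg_p + Σ_p (w_p − du_p)·e_p` — replacing
the weight `w` by `du` in a pairing costs the NORMAL-EQUATION DEFECT `Σ_p (w_p − du_p)·dg_p` (which least-squares normal equations tested
against `g` would kill) plus the pairing of `w − du` with the NON-EXACT part `e`. [folklore] -/
theorem sum_mul_eq_sum_mul_add_defect (w du f dg e : ι → ℝ) (hf : ∀ p, f p = dg p + e p) :
    ∑ p, w p * f p = ∑ p, du p * f p + ∑ p, (w p - du p) * dg p + ∑ p, (w p - du p) * e p := by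
  rw [← Finset.sum_add_distrib, ← Finset.sum_add_distrib]
  exact Finset.sum_congr rfl fun p _ => by rw [hf p]; ring

/-- The same as an inequality with a pointwise bound on the non-exact part over the joint support. [folklore] -/
theorem abs_sum_mul_le_add_defect (w du f dg e : ι → ℝ) (hf : ∀ p, f p = dg p + e p) {ε : ℝ}
    (he : ∀ p, (w p ≠ 0 ∨ du p ≠ 0) → |e p| ≤ ε) :
    |∑ p, w p * f p| ≤ |∑ p, du p * f p| + |∑ p, (w p - du p) * dg p| + ε * ∑ p, |w p - du p| := by
  rw [sum_mul_eq_sum_mul_add_defect w du f dg e hf]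
  have h3 : |∑ p, (w p - du p) * e p| ≤ ε * ∑ p, |w p - du p| := by
    rw [Finset.mul_sum]
    refine (Finset.abs_sum_le_sum_abs _ _).trans (Finset.sum_le_sum fun p _ => ?_)
    by_cases hp : w p ≠ 0 ∨ du p ≠ 0
    · rw [abs_mul, mul_comm]
      exact mul_le_mul_of_nonneg_right (he p hp) (abs_nonneg _)
    · simp only [not_or, not_not] at hp
      rw [hp.1, hp.2, sub_zero, zero_mul, abs_zero, mul_zero]
  calc |∑ p, du p * f p + ∑ p, (w p - du p) * dg p + ∑ p, (w p - du p) * e p|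
      ≤ |∑ p, du p * f p + ∑ p, (w p - du p) * dg p| + |∑ p, (w p - du p) * e p| := abs_add_le _ _
    _ ≤ (|∑ p, du p * f p| + |∑ p, (w p - du p) * dg p|) + ε * ∑ p, |w p - du p| :=
        add_le_add (abs_add_le _ _) h3
    _ = _ := by ring

end Defect

/-! ## §4  The identification -/

section Identification

open UnitScaleGibbsActionDerivativeSlotCalculus (slotBond)

variable {P : Params}

/-- Repackaging: the weighted sum of Pauli traces is the real trace of the `𝔰𝔲(2)`-VALUED curl pairing — with the test field
`u_α := u⁰ ⊗ τ_α`, `(du_α)_p = (du⁰)_p • τ_α`, the right-hand side of the identification is `Σ_p Re Tr((du_α)_p · (↑V(∂p) − 1))`, the flat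
flux pairing of ✓`UnitScaleGibbsFirstVariationFluxPairing` (times `−N`). [folklore] -/
theorem sum_mul_re_trace_eq_re_trace_sum (d : Plaq P 0 → ℝ) (T : Matrix (Fin 2) (Fin 2) ℂ) (X : Plaq P 0 → Matrix (Fin 2) (Fin 2) ℂ) :
    ∑ p, d p * (T * X p).trace.re = (∑ p, ((d p : ℂ) • T) * X p).trace.re := by
  rw [Matrix.trace_sum, Complex.re_sum]
  refine Finset.sum_congr rfl fun p _ => ?_
  rw [Matrix.smul_mul, Matrix.trace_smul, smul_eq_mul, Complex.re_ofReal_mul]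

/-- In the gauge-group interface, `dist₁(V(∂p)) ≤ Σ_i dist₁(V(slot i))` — hence `≤ 4η` when the four slots are `η`-close to `1`.
[cite: Balaban1985Averaging, (19) p.21] -/
theorem norm_coe_plaqHol_sub_one_le (V : GaugeField P 0 (Matrix.specialUnitaryGroup (Fin 2) ℂ)) (p : Plaq P 0) {η : ℝ}
    (hV : ∀ i : Fin 4, ‖(V (slotBond p i) : Matrix (Fin 2) (Fin 2) ℂ) - 1‖ ≤ η) :
    ‖((GaugeField.plaqHol V p : Matrix.specialUnitaryGroup (Fin 2) ℂ) : Matrix (Fin 2) (Fin 2) ℂ) - 1‖ ≤ 4 * η := by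
  have h0 := hV 0; have h1 := hV 1; have h2 := hV 2; have h3 := hV 3
  simp only [slotBond, Matrix.cons_val_zero, Matrix.cons_val_one, Matrix.head_cons, Matrix.cons_val_two, Matrix.tail_cons,
    Matrix.cons_val_three] at h0 h1 h2 h3
  have key : dist1 (GaugeField.plaqHol V p) ≤ 4 * η := by
    unfold GaugeField.plaqHol
    calc dist1 (V ⟨p.src, p.μ⟩ * V ⟨p.src.shift p.μ, p.ν⟩ * (V ⟨p.src.shift p.ν, p.μ⟩)⁻¹ * (V ⟨p.src, p.ν⟩)⁻¹)
        ≤ dist1 (V ⟨p.src, p.μ⟩ * V ⟨p.src.shift p.μ, p.ν⟩ * (V ⟨p.src.shift p.ν, p.μ⟩)⁻¹) + dist1 ((V ⟨p.src, p.ν⟩)⁻¹) :=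
          GaugeGroup.dist1_mul_le _ _
      _ ≤ (dist1 (V ⟨p.src, p.μ⟩ * V ⟨p.src.shift p.μ, p.ν⟩) + dist1 ((V ⟨p.src.shift p.ν, p.μ⟩)⁻¹)) +
            dist1 ((V ⟨p.src, p.ν⟩)⁻¹) := by gcongr; exact GaugeGroup.dist1_mul_le _ _
      _ ≤ ((dist1 (V ⟨p.src, p.μ⟩) + dist1 (V ⟨p.src.shift p.μ, p.ν⟩)) + dist1 ((V ⟨p.src.shift p.ν, p.μ⟩)⁻¹)) +
            dist1 ((V ⟨p.src, p.ν⟩)⁻¹) := by gcongr; exact GaugeGroup.dist1_mul_le _ _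
      _ = dist1 (V ⟨p.src, p.μ⟩) + dist1 (V ⟨p.src.shift p.μ, p.ν⟩) + dist1 (V ⟨p.src.shift p.ν, p.μ⟩) +
            dist1 (V ⟨p.src, p.ν⟩) := by rw [GaugeGroup.dist1_inv, GaugeGroup.dist1_inv]
      _ ≤ η + η + η + η := by
          gcongr
          · exact h0
          · exact h1
          · exact h2
          · exact h3
      _ = 4 * η := by ring
  exact key

/-- ★★★ **THE IDENTIFICATION WITH ITS NET-FLUX DEFECT (LINE 28 `stub_linTest`, construction C3)**.  Let `V` be an `SU(2)` configuration
(in the application: the axial-gauge representative of a box), `w : Plaq → ℝ` real plaquette weights (in the application ✓`linWeight j a`),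
`u : PBond → ℝ` ANY real bond function with curl `(du)_p := u(b₀) + u(b₁) − u(b₂) − u(b₃)`, and suppose the four slot variables of every
plaquette in `supp w ∪ supp du` are within `η ≤ 1` of `1`.  With the real 1-forms `g_α b := Re Tr(τ_α(↑V_b − 1))` (`τ_α = iσ_α`):
`‖Σ_p w_p (↑V(∂p) − 1)‖ ≤ Σ_α |Σ_p (du)_p·Re Tr(τ_α(↑V(∂p) − 1))| + Σ_α |Σ_p (w_p − (du)_p)·(dg_α)_p| + 132η²·Σ_p|w_p − (du)_p| + 8η²·Σ_p|w_p|`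
(operator norm).  The first term is the flat pairing of the `𝔰𝔲(2)`-valued curl `d(u ⊗ τ_α)` (`sum_mul_re_trace_eq_re_trace_sum`); the second is
the NORMAL-EQUATION DEFECT `D_α := ⟨w − du, dg_α⟩` — NO normal equations are assumed here: `D_α` is displayed, not hidden.  HONEST NOTE on `D_α`
(w5-19936 g16 (NET-FLUX), px5 g10 kit j334943): for `w` with non-zero orientation sums (e.g. `linWeight j a`, `Σ_p = (L²)^j`) NO `u` whose curl
is supported on the plaquettes where `g_α` is the small-field potential makes `D_α` vanish for all `g_α` (double counting: box-supported curls
have zero orientation sums); with (D3♭)'s full-box least-squares potential the defect is EXACTLY the pairing of the return current on the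
box wall — the seam LINE 28 must still control. [cite: GrossCMP1983, Thm 2.2] -/
theorem norm_linProxy_le_fluxPairing_add_defect (V : GaugeField P 0 (Matrix.specialUnitaryGroup (Fin 2) ℂ))
    (w : Plaq P 0 → ℝ) (u : PBond P 0 → ℝ) {η : ℝ} (hη0 : 0 ≤ η) (hη1 : η ≤ 1)
    (hV : ∀ p : Plaq P 0, (w p ≠ 0 ∨ (u (slotBond p 0) + u (slotBond p 1) - u (slotBond p 2) - u (slotBond p 3)) ≠ 0) →
      ∀ i : Fin 4, ‖(V (slotBond p i) : Matrix (Fin 2) (Fin 2) ℂ) - 1‖ ≤ η) :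
    ‖∑ p, (w p : ℂ) • (((GaugeField.plaqHol V p : Matrix.specialUnitaryGroup (Fin 2) ℂ) : Matrix (Fin 2) (Fin 2) ℂ) - 1)‖ ≤
      ∑ α : Fin 3, |∑ p, (u (slotBond p 0) + u (slotBond p 1) - u (slotBond p 2) - u (slotBond p 3)) *
          ((I • pauli α) * (((GaugeField.plaqHol V p : Matrix.specialUnitaryGroup (Fin 2) ℂ) : Matrix (Fin 2) (Fin 2) ℂ) - 1)).trace.re|
        + ∑ α : Fin 3, |∑ p, (w p - (u (slotBond p 0) + u (slotBond p 1) - u (slotBond p 2) - u (slotBond p 3))) *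
          ((((I • pauli α) * ((V (slotBond p 0) : Matrix (Fin 2) (Fin 2) ℂ) - 1)).trace.re +
            ((I • pauli α) * ((V (slotBond p 1) : Matrix (Fin 2) (Fin 2) ℂ) - 1)).trace.re -
            ((I • pauli α) * ((V (slotBond p 2) : Matrix (Fin 2) (Fin 2) ℂ) - 1)).trace.re -
            ((I • pauli α) * ((V (slotBond p 3) : Matrix (Fin 2) (Fin 2) ℂ) - 1)).trace.re))|
        + 132 * η ^ 2 * ∑ p, |w p - (u (slotBond p 0) + u (slotBond p 1) - u (slotBond p 2) - u (slotBond p 3))|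
        + 8 * η ^ 2 * ∑ p, |w p| := by
  -- abbreviations
  set du : Plaq P 0 → ℝ := fun p => u (slotBond p 0) + u (slotBond p 1) - u (slotBond p 2) - u (slotBond p 3) with hdu
  set X : Plaq P 0 → Matrix (Fin 2) (Fin 2) ℂ :=
    fun p => ((GaugeField.plaqHol V p : Matrix.specialUnitaryGroup (Fin 2) ℂ) : Matrix (Fin 2) (Fin 2) ℂ) - 1 with hX
  -- Step 1: Theorem A on the proxy
  have hA := norm_sum_smul_sub_one_le (Finset.univ : Finset (Plaq P 0)) w (fun p => GaugeField.plaqHol V p)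
  -- Step 2: the scalar part `½ Σ |w_p| ‖X_p‖² ≤ 8η² Σ |w_p|`
  have hscal : (1 / 2 : ℝ) * ∑ p, |w p| * ‖X p‖ ^ 2 ≤ 8 * η ^ 2 * ∑ p, |w p| := by
    rw [Finset.mul_sum, Finset.mul_sum]
    refine Finset.sum_le_sum fun p _ => ?_
    by_cases hp : w p = 0
    · simp [hp]
    · have hXp : ‖X p‖ ≤ 4 * η := norm_coe_plaqHol_sub_one_le V p (hV p (Or.inl hp))
      have hXp0 : 0 ≤ ‖X p‖ := norm_nonneg _
      have : ‖X p‖ ^ 2 ≤ (4 * η) ^ 2 := pow_le_pow_left₀ hXp0 hXp 2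
      calc (1 / 2 : ℝ) * (|w p| * ‖X p‖ ^ 2) ≤ (1 / 2) * (|w p| * (4 * η) ^ 2) := by gcongr
        _ = 8 * η ^ 2 * |w p| := by ring
  -- Step 3: per colour, the defect identity with the second-order bound on the non-exact part
  have hcol : ∀ α : Fin 3, |((I • pauli α) * ∑ p, (w p : ℂ) • X p).trace.re| ≤
      |∑ p, du p * ((I • pauli α) * X p).trace.re| +
        |∑ p, (w p - du p) *
          ((((I • pauli α) * ((V (slotBond p 0) : Matrix (Fin 2) (Fin 2) ℂ) - 1)).trace.re +
            ((I • pauli α) * ((V (slotBond p 1) : Matrix (Fin 2) (Fin 2) ℂ) - 1)).trace.re -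
            ((I • pauli α) * ((V (slotBond p 2) : Matrix (Fin 2) (Fin 2) ℂ) - 1)).trace.re -
            ((I • pauli α) * ((V (slotBond p 3) : Matrix (Fin 2) (Fin 2) ℂ) - 1)).trace.re))| +
        44 * η ^ 2 * ∑ p, |w p - du p| := by
    intro α
    rw [re_trace_mul_sum_smul]
    -- the real 1-form `g_α`, its curl `dg`, the non-exact part `e`
    set g : PBond P 0 → ℝ := fun b => ((I • pauli α) * ((V b : Matrix (Fin 2) (Fin 2) ℂ) - 1)).trace.re with hg
    set f : Plaq P 0 → ℝ := fun p => ((I • pauli α) * X p).trace.re with hf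
    set dg : Plaq P 0 → ℝ := fun p => g (slotBond p 0) + g (slotBond p 1) - g (slotBond p 2) - g (slotBond p 3) with hdg
    set e : Plaq P 0 → ℝ := fun p => f p - dg p with he
    have hfe : ∀ p, f p = dg p + e p := fun p => by simp only [he]; ring
    have hebound : ∀ p, (w p ≠ 0 ∨ du p ≠ 0) → |e p| ≤ 44 * η ^ 2 := by
      intro p hp
      have h := abs_re_trace_plaq_sub_curl_le V p (I • pauli α) (conjTranspose_I_smul_pauli α) (norm_I_smul_pauli_le_two α)
        hη0 hη1 (hV p hp)
      simpa only [he, hf, hdg, hg, hX] using h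
    exact abs_sum_mul_le_add_defect w du f dg e hfe hebound
  -- Step 4: assemble
  have hsumcol : ∑ α : Fin 3, |((I • pauli α) * ∑ p, (w p : ℂ) • X p).trace.re| ≤
      ∑ α : Fin 3, |∑ p, du p * ((I • pauli α) * X p).trace.re| +
      ∑ α : Fin 3, |∑ p, (w p - du p) *
          ((((I • pauli α) * ((V (slotBond p 0) : Matrix (Fin 2) (Fin 2) ℂ) - 1)).trace.re +
            ((I • pauli α) * ((V (slotBond p 1) : Matrix (Fin 2) (Fin 2) ℂ) - 1)).trace.re -
            ((I • pauli α) * ((V (slotBond p 2) : Matrix (Fin 2) (Fin 2) ℂ) - 1)).trace.re -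
            ((I • pauli α) * ((V (slotBond p 3) : Matrix (Fin 2) (Fin 2) ℂ) - 1)).trace.re))| +
      132 * η ^ 2 * ∑ p, |w p - du p| := by
    calc ∑ α : Fin 3, |((I • pauli α) * ∑ p, (w p : ℂ) • X p).trace.re|
        ≤ ∑ α : Fin 3, (|∑ p, du p * ((I • pauli α) * X p).trace.re| +
          |∑ p, (w p - du p) *
            ((((I • pauli α) * ((V (slotBond p 0) : Matrix (Fin 2) (Fin 2) ℂ) - 1)).trace.re +
              ((I • pauli α) * ((V (slotBond p 1) : Matrix (Fin 2) (Fin 2) ℂ) - 1)).trace.re -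
              ((I • pauli α) * ((V (slotBond p 2) : Matrix (Fin 2) (Fin 2) ℂ) - 1)).trace.re -
              ((I • pauli α) * ((V (slotBond p 3) : Matrix (Fin 2) (Fin 2) ℂ) - 1)).trace.re))| +
          44 * η ^ 2 * ∑ p, |w p - du p|) := Finset.sum_le_sum fun α _ => hcol α
      _ = _ := by rw [Finset.sum_add_distrib, Finset.sum_add_distrib, Finset.sum_const, Finset.card_fin]; ring
  calc ‖∑ p, (w p : ℂ) • X p‖
      ≤ ∑ α : Fin 3, |((I • pauli α) * ∑ p, (w p : ℂ) • X p).trace.re| + (1 / 2) * ∑ p, |w p| * ‖X p‖ ^ 2 := hA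
    _ ≤ _ := add_le_add hsumcol hscal
    _ = _ := by ring

end Identification

end Summit.QuantumFields.YangMills.Theorems.UnitScaleGibbsLinProxyFluxIdentification

end
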